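import Mathlib
import Literature.Computability.AlgebraicComplexity.GroupTheoreticMatMul

/-!
# The Latin coset 3-design: an STPP `(s,s,s)³` family of order `4s³` for EVERY `s ≥ 2` (cell mm-stpp, eng-1 g6)

In `G = ℤ/s × ℤ/s × ℤ/s × ℤ/2 × ℤ/2` let `K₀, K₁, K₂ ≅ ℤ/s` be the three coordinate subgroups of the `(ℤ/s)³` part.
Member `t ∈ {0,1,2}` takes `A_t` = a coset of `K_t`, `B_t` = a coset of `K_{t+1}`, `C_t` = a coset of `K_{t+2}` (indices mod 3 —
a Latin square of subgroups), with the nine coset representatives ("labels") below: their `(ℤ/2)²` parts separate every cross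
pattern whose subgroup sum is the whole `(ℤ/s)³` (all patterns with two equal indices and the three cyclic ones), and three unit
entries in the `(ℤ/s)³` parts separate the three anti-cyclic patterns (whose subgroup sums are `K_a ⊕ K_b` only).  Each member is
TPP because its three subgroups are independent.  Hence `E₃(s) := (least abelian order hosting an STPP (s,s,s)³) ≤ 4 s³` for all
`s ≥ 2`; the cell's search finds no smaller host for `s = 2, 3` (32 = pub-omega's `exists_isSTPP_222cube_zmod2_pow5`, 108) and none
below 232 for `s = 4` (search-grade).  The label system was found by brute force: the forced conditions are infeasible with a label
quotient `ℤ/2, ℤ/3, ℤ/4, ℤ/5` and first feasible in `(ℤ/2)²`.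

WHAT THIS IS NOT: no statement about ω (these families are THIN, `2·s³ ≤ 4s³`, and `3·s^{5/2} < 4s³`: they beat nothing); no census
number; an existence UPPER END only.
-/

-- single-conjunct summit: the mandated namespace repeats `MatrixMultiplication`.
set_option linter.dupNamespace false

namespace Summit.MatrixMultiplication.MatrixMultiplication.Theorems.STPPLatinCosetDesign

open Finset
open Literature.Computability.AlgebraicComplexity (IsSTPP)

/-- The ambient group `ℤ/s × ℤ/s × ℤ/s × ℤ/2 × ℤ/2` (right-nested product). [original] -/
abbrev Grp (s : ℕ) := ZMod s × ZMod s × ZMod s × ZMod 2 × ZMod 2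

variable (s : ℕ) [NeZero s]

/-- Coset of the first coordinate subgroup `K₀` through `g`. [original] -/
def cosetK0 (g : Grp s) : Finset (Grp s) := univ.image fun x : ZMod s => g + (x, 0, 0, 0, 0)
/-- Coset of the second coordinate subgroup `K₁` through `g`. [original] -/
def cosetK1 (g : Grp s) : Finset (Grp s) := univ.image fun x : ZMod s => g + (0, x, 0, 0, 0)
/-- Coset of the third coordinate subgroup `K₂` through `g`. [original] -/
def cosetK2 (g : Grp s) : Finset (Grp s) := univ.image fun x : ZMod s => g + (0, 0, x, 0, 0)

/-- The `A`-blocks of the Latin coset design: `A₀ ∥ K₀`, `A₁ ∥ K₁`, `A₂ ∥ K₂` (labels `(0;0,0)`, `(e₀;1,0)`, `(0;1,1)`). [original] -/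
def latinA : Fin 3 → Finset (Grp s) :=
  ![cosetK0 s (0, 0, 0, 0, 0), cosetK1 s (1, 0, 0, 1, 0), cosetK2 s (0, 0, 0, 1, 1)]
/-- The `B`-blocks: `B₀ ∥ K₁`, `B₁ ∥ K₂`, `B₂ ∥ K₀` (labels `(0;1,0)`, `(e₁;1,0)`, `(0;0,0)`). [original] -/
def latinB : Fin 3 → Finset (Grp s) :=
  ![cosetK1 s (0, 0, 0, 1, 0), cosetK2 s (0, 1, 0, 1, 0), cosetK0 s (0, 0, 0, 0, 0)]
/-- The `C`-blocks: `C₀ ∥ K₂`, `C₁ ∥ K₀`, `C₂ ∥ K₁` (labels `(0;1,0)`, `(e₂;1,1)`, `(0;1,1)`). [original] -/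
def latinC : Fin 3 → Finset (Grp s) :=
  ![cosetK2 s (0, 0, 0, 1, 0), cosetK0 s (0, 0, 1, 1, 1), cosetK1 s (0, 0, 0, 1, 1)]

/-- Every block of the design has exactly `s` elements. [original] -/
theorem card_blocks (t : Fin 3) :
    (latinA s t).card = s ∧ (latinB s t).card = s ∧ (latinC s t).card = s := by
  have h0 : ∀ g : Grp s, (cosetK0 s g).card = s := fun g => by
    rw [cosetK0, card_image_of_injective _ (fun x y hxy => by simpa [Prod.ext_iff] using hxy), card_univ, ZMod.card]
  have h1 : ∀ g : Grp s, (cosetK1 s g).card = s := fun g => by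
    rw [cosetK1, card_image_of_injective _ (fun x y hxy => by simpa [Prod.ext_iff] using hxy), card_univ, ZMod.card]
  have h2 : ∀ g : Grp s, (cosetK2 s g).card = s := fun g => by
    rw [cosetK2, card_image_of_injective _ (fun x y hxy => by simpa [Prod.ext_iff] using hxy), card_univ, ZMod.card]
  fin_cases t <;> simp [latinA, latinB, latinC, h0, h1, h2]

/-- **The Latin coset design is an STPP family** (`(s,s,s)³` in a group of order `4s³`, every `s ≥ 2`). [original] -/
theorem isSTPP_latin [Fact (1 < s)] : IsSTPP (latinA s) (latinB s) (latinC s) := by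
  intro i j k z hz z' hz' w hw w' hw' v hv v' hv' hrel
  fin_cases i <;> fin_cases j <;> fin_cases k
  all_goals
    simp only [latinA, latinB, latinC, cosetK0, cosetK1, cosetK2, Fin.zero_eta, Fin.mk_one, Fin.reduceFinMk, Fin.isValue,
      Matrix.cons_val_zero, Matrix.cons_val_one, Matrix.cons_val, mem_image, mem_univ, true_and] at hz hz' hw hw' hv hv'
    obtain ⟨xz, rfl⟩ := hz
    obtain ⟨xz', rfl⟩ := hz'
    obtain ⟨xw, rfl⟩ := hw
    obtain ⟨xw', rfl⟩ := hw'
    obtain ⟨xv, rfl⟩ := hv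
    obtain ⟨xv', rfl⟩ := hv'
    simp only [Prod.ext_iff, Prod.fst_add, Prod.snd_add, Prod.fst_sub, Prod.snd_sub, Prod.fst_zero, Prod.snd_zero] at hrel
    obtain ⟨e1, e2, e3, e4, e5⟩ := hrel
  all_goals first
    | (exfalso; revert e4; decide)
    | (exfalso; revert e5; decide)
    | (exfalso; simp at e1; done)
    | (exfalso; simp at e2; done)
    | (exfalso; simp at e3; done)
    | (simp only [zero_add, add_zero, sub_self, sub_eq_zero] at e1 e2 e3
       refine ⟨rfl, rfl, ?_, ?_, ?_⟩ <;> simp [e1, e2, e3])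

/-- **`E₃(s) ≤ 4s³`** in existential form: for every `s ≥ 2` the abelian group `ℤ/s × ℤ/s × ℤ/s × ℤ/2 × ℤ/2` (order `4s³`) hosts an
STPP family of three triples of shape `(s,s,s)`. [original] -/
theorem exists_isSTPP_cube_triple (hs : 1 < s) :
    ∃ A B C : Fin 3 → Finset (Grp s), IsSTPP A B C ∧ ∀ t, (A t).card = s ∧ (B t).card = s ∧ (C t).card = s :=
  haveI : Fact (1 < s) := ⟨hs⟩
  ⟨latinA s, latinB s, latinC s, isSTPP_latin s, card_blocks s⟩

end Summit.MatrixMultiplication.MatrixMultiplication.Theorems.STPPLatinCosetDesign
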